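import Literature.AlgebraicGeometry.HodgeTheory.DiagonalCharacterEigenspace
import Literature.AlgebraicGeometry.HodgeTheory.RationalClassesIndependent
import Mathlib.RingTheory.Polynomial.Cyclotomic.Roots
import Mathlib.RingTheory.RootsOfUnity.Complex
import HarnessLib

/-!
# The isotypic support of a rational class is Galois-stable

Family `hodge`, layer `Literature/AlgebraicGeometry/HodgeTheory`. Brick of the middle-degree case of
the named fact `hodgeClasses_algebraic_fermat` (file `FermatHodgeConjecture`): the "defined over `ℚ`"
half of Shioda's description of the Hodge classes of the Fermat variety (Proc. Japan Acad. 55A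
(1979) §1/§4; Math. Ann. 245 (1979) §1) and of Ran's Prop. 1.7 (iii) (Compositio Math. 42 (1980)
p. 125: "Let `(ℤ/m)ˣ` act on the characters by coordinatewise multiplication. Then the Poincaré dual
of `[FᵏPⁿ(Vⁿₘ) ∩ Hⁿ(V, ℚ)] ⊗ ℂ` is `⊕{H_χ : χ relevant, s(tχ) ≤ (n-k+1)m for all t ∈ (ℤ/m)ˣ}`"):
the set of characters `χ` of a finite group `G` of diagonal symmetries whose isotypic projector
`π_χ` does not kill a RATIONAL class `c` is stable under `χ ↦ χᵗ`, `t` prime to `|G|` — the orbit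
of `χ` under `Gal(ℚ(ζ_{|G|})/ℚ)`. Everything is PROVED, for the tree's carriers of
`DiagonalCharacterEigenspace` (`X_F = V₊(F) ⊂ ℙⁿ⁺¹_ℂ`, `G ≤ diagonalStabilizer F` finite acting by
pull-back `g_a^*` on `Hᵏ(X_F(ℂ); ℂ)`, `π_χ = |G|⁻¹ Σ_a χ(a)⁻¹ g_a^*`):

* `sum_pow_smul_eq_zero_iff_of_isPrimitiveRoot` — the linear algebra: in a complex vector space
  with a `ℚ`-structure `R` ("rational vectors": a `ℚ`-subspace whose `ℚ`-linearly independent finite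
  families are `ℂ`-linearly independent), for rational `v₁, …, v_N`, exponents `eᵢ` and two PRIMITIVE
  `m`-th roots of unity `ζ, ξ`: `Σ ζ^{eᵢ} vᵢ = 0 ↔ Σ ξ^{eᵢ} vᵢ = 0`. Proof: in a `ℚ`-basis `(b_j)` of the
  `ℚ`-span of the `vᵢ` the coefficient of `b_j` is `P_j(ζ)` with `P_j ∈ ℚ[X]`, the `b_j` are
  `ℂ`-independent, and `P_j(ζ) = 0 ↔ Φ_m ∣ P_j ↔ P_j(ξ) = 0` (`Φ_m = minpoly_ℚ ζ = minpoly_ℚ ξ`, Mathlib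
  `Polynomial.cyclotomic_eq_minpoly_rat`).
* `eigenProjector_eq_zero_iff_pow` — **for `c ∈ Hᵏ(X_F(ℂ); ℂ)` rational and `s` prime to `|G|`,
  `π_χ c = 0 ↔ π_{χˢ} c = 0`**: the classes `g_a^* c` are rational (`IsRationalClass.diagonalMap`),
  rational classes form a `ℚ`-structure (`linearIndependent_of_isRationalClass`, file
  `RationalClassesIndependent`), and `χ(a)⁻¹ = ζ^{e_a}`, `χˢ(a)⁻¹ = (ζˢ)^{e_a}` for `ζ = e^{2πi/|G|}`.
  In particular (`s = |G| - 1`) `π_χ c = 0 ↔ π_{χ⁻¹} c = 0` (`eigenProjector_eq_zero_iff_inv`).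

For the Fermat variety (`G = μₘⁿ⁺²`, `χ = χ_α`, `χ_αᵗ = χ_{tα}`) this is: the support
`{α | π_α c ≠ 0}` of a rational class is stable under `(ℤ/m)ˣ`, whence Shioda's condition
"`|tα| = n/2 + 1` for ALL `t ∈ (ℤ/m)ˣ`" in the definition of `𝔅ⁿₘ` (file `FermatHodgeCharacters`).

## References

* [Ran1980] Z. Ran, Cycles on Fermat hypersurfaces, Compositio Math. 42 (1980) 121–142, §1
  Prop. 1.7 (iii) (p. 125) (text read, numdam).
* [Shioda1979PJA] T. Shioda, The Hodge conjecture and the Tate conjecture for Fermat varieties,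
  Proc. Japan Acad. 55A (1979) 111–114, §1 eq. (2) ("for all `t ∈ (ℤ/m)ˣ`"), §4 (text read).
* [SerreLinearRepresentations1977] J.-P. Serre, Linear Representations of Finite Groups, §12.1
  (rationality: the character of a representation defined over `ℚ` is `Gal`-invariant).
-/

noncomputable section

open Polynomial

namespace Literature.AlgebraicGeometry.HodgeTheory

/-! ### Linear algebra: combinations with root-of-unity coefficients of rational vectors -/

section LinearAlgebra

variable {V : Type*} [AddCommGroup V] [Module ℂ V]

/-- **Galois stability of the vanishing of a cyclotomic combination of rational vectors.** Let
`R ⊆ V` be a `ℚ`-structure of the complex vector space `V` (a `ℚ`-subspace such that finite families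
in `R` without rational relations are `ℂ`-linearly independent), `vᵢ ∈ R` finitely many rational
vectors, `eᵢ ∈ ℕ`, and `ζ, ξ` two primitive `m`-th roots of unity. Then
`Σᵢ ζ^{eᵢ} vᵢ = 0 ↔ Σᵢ ξ^{eᵢ} vᵢ = 0`: in a `ℚ`-basis `(b_j)` of `span_ℚ {vᵢ} ⊆ R` both sums read
`Σ_j P_j(·) b_j` with `P_j ∈ ℚ[X]`, the `b_j` are `ℂ`-independent, and
`P_j(ζ) = 0 ↔ Φ_m ∣ P_j ↔ P_j(ξ) = 0` since `Φ_m` is the minimal polynomial of both.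
[cite: SerreLinearRepresentations1977, §12.1] -/
theorem sum_pow_smul_eq_zero_iff_of_isPrimitiveRoot {R : Set V} (h0 : (0 : V) ∈ R)
    (hadd : ∀ ⦃x y : V⦄, x ∈ R → y ∈ R → x + y ∈ R) (hsmul : ∀ (q : ℚ) ⦃x : V⦄, x ∈ R → (q : ℂ) • x ∈ R)
    (hind : ∀ ⦃d : ℕ⦄ (b : Fin d → V), (∀ j, b j ∈ R) →
      (∀ q : Fin d → ℚ, ∑ j, ((q j : ℚ) : ℂ) • b j = 0 → q = 0) → LinearIndependent ℂ b)
    {ι : Type*} [Fintype ι] {v : ι → V} (hv : ∀ i, v i ∈ R) (e : ι → ℕ)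
    {m : ℕ} [NeZero m] {ζ ξ : ℂ} (hζ : IsPrimitiveRoot ζ m) (hξ : IsPrimitiveRoot ξ m) :
    ∑ i, ζ ^ e i • v i = 0 ↔ ∑ i, ξ ^ e i • v i = 0 := by
  classical
  -- `V` as a `ℚ`-vector space through `ℚ ⊆ ℂ`
  letI : Module ℚ V := Module.compHom V (algebraMap ℚ ℂ)
  have hq : ∀ (q : ℚ) (x : V), q • x = (q : ℂ) • x := fun q x ↦ by
    show (algebraMap ℚ ℂ q) • x = _
    rw [eq_ratCast]
  let S : Submodule ℚ V :=
    { carrier := R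
      zero_mem' := h0
      add_mem' := fun hx hy ↦ hadd hx hy
      smul_mem' := fun q x hx ↦ by
        show q • x ∈ R
        rw [hq]
        exact hsmul q hx }
  let W : Submodule ℚ V := Submodule.span ℚ (Set.range v)
  have hWS : W ≤ S := Submodule.span_le.mpr (Set.range_subset_iff.mpr hv)
  haveI : Module.Finite ℚ W := Module.Finite.span_of_finite ℚ (Set.finite_range v)
  -- a `ℚ`-basis of the `ℚ`-span of the `vᵢ`
  set d := Module.finrank ℚ W
  let B := Module.finBasis ℚ W
  let b : Fin d → V := fun j ↦ (B j : V)
  have hbR : ∀ j, b j ∈ R := fun j ↦ hWS (B j).2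
  have hcoe : ∀ q : Fin d → ℚ, ((∑ j, q j • B j : W) : V) = ∑ j, ((q j : ℚ) : ℂ) • b j := by
    intro q
    rw [Submodule.coe_sum]
    refine Finset.sum_congr rfl fun j _ ↦ ?_
    rw [Submodule.coe_smul, hq]
  have hbind : ∀ q : Fin d → ℚ, ∑ j, ((q j : ℚ) : ℂ) • b j = 0 → q = 0 := by
    intro q hq0
    have hW0 : (∑ j, q j • B j : W) = 0 := by
      apply Subtype.ext
      rw [hcoe, Submodule.coe_zero]
      exact hq0
    funext j
    exact Fintype.linearIndependent_iff.mp B.linearIndependent q hW0 j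
  have hli : LinearIndependent ℂ b := hind b hbR hbind
  -- rational coordinates of the `vᵢ`
  let c : ι → Fin d → ℚ := fun i j ↦ B.repr ⟨v i, Submodule.subset_span ⟨i, rfl⟩⟩ j
  have hvi : ∀ i, v i = ∑ j, ((c i j : ℚ) : ℂ) • b j := by
    intro i
    have h := congrArg Subtype.val (B.sum_repr ⟨v i, Submodule.subset_span ⟨i, rfl⟩⟩)
    rw [hcoe] at h
    exact h.symm
  -- the polynomials `P_j = Σᵢ c_{ij} X^{eᵢ} ∈ ℚ[X]`
  let P : Fin d → ℚ[X] := fun j ↦ ∑ i, Polynomial.C (c i j) * Polynomial.X ^ e i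
  have hP : ∀ (θ : ℂ) (j : Fin d), aeval θ (P j) = ∑ i, ((c i j : ℚ) : ℂ) * θ ^ e i := by
    intro θ j
    simp only [P, map_sum, map_mul, aeval_C, map_pow, aeval_X, eq_ratCast]
  have hsum : ∀ θ : ℂ, ∑ i, θ ^ e i • v i = ∑ j, (aeval θ (P j)) • b j := by
    intro θ
    simp_rw [hP, Finset.sum_smul, hvi, Finset.smul_sum, smul_smul]
    rw [Finset.sum_comm]
    refine Finset.sum_congr rfl fun j _ ↦ Finset.sum_congr rfl fun i _ ↦ ?_
    rw [mul_comm]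
  have hzero : ∀ θ : ℂ, ∑ i, θ ^ e i • v i = 0 ↔ ∀ j, aeval θ (P j) = 0 := by
    intro θ
    rw [hsum θ]
    refine ⟨fun h j ↦ Fintype.linearIndependent_iff.mp hli _ h j, fun h ↦ ?_⟩
    exact Finset.sum_eq_zero fun j _ ↦ by rw [h j, zero_smul]
  have hmin : ∀ θ : ℂ, IsPrimitiveRoot θ m → ∀ j, aeval θ (P j) = 0 ↔ cyclotomic m ℚ ∣ P j := by
    intro θ hθ j
    rw [Polynomial.cyclotomic_eq_minpoly_rat hθ (NeZero.pos m), minpoly.dvd_iff]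
  rw [hzero ζ, hzero ξ]
  exact forall_congr' fun j ↦ by rw [hmin ζ hζ j, hmin ξ hξ j]

end LinearAlgebra

/-! ### The isotypic projectors of a rational class -/

section Projector

open CategoryTheory AlgebraicGeometry
open Literature.AlgebraicGeometry.Motives Literature.AlgebraicTopology.SingularHomology

variable {n : ℕ} (F : MvPolynomial (Fin (n + 2)) ℂ) {G : Subgroup (Fin (n + 2) → ℂˣ)} [Fintype G]
  (hG : G ≤ diagonalStabilizer F) (χ : G →* ℂˣ) (k : ℕ)

/-- The values of a character of the finite group `G` are `|G|`-th roots of unity: `χ(a)⁻¹` is a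
power of `ζ = e^{2πi/|G|}`. [folklore] -/
theorem exists_inv_coe_eq_pow (a : G) :
    ∃ i < Fintype.card G, Complex.exp (2 * Real.pi * Complex.I / Fintype.card G) ^ i = ((χ a : ℂˣ) : ℂ)⁻¹ := by
  haveI : NeZero (Fintype.card G) := ⟨Fintype.card_ne_zero⟩
  refine (Complex.isPrimitiveRoot_exp _ (NeZero.ne _)).eq_pow_of_pow_eq_one ?_
  rw [inv_pow, ← Units.val_pow_eq_pow_val, ← map_pow, pow_card_eq_one, map_one, Units.val_one, inv_one]

/-- **The isotypic support of a rational class is Galois-stable.** For `G ≤ diagonalStabilizer F`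
finite, `χ : G → ℂˣ`, `c ∈ Hᵏ(X_F(ℂ); ℂ)` a RATIONAL class and `s` prime to `|G|`:
`π_χ c = 0 ↔ π_{χˢ} c = 0` (`π_χ = |G|⁻¹ Σ_a χ(a)⁻¹ g_a^*`, `eigenProjector`). The classes `g_a^* c`
are rational, `χ(a)⁻¹ = ζ^{e_a}` and `χˢ(a)⁻¹ = (ζˢ)^{e_a}` with `ζ = e^{2πi/|G|}` and `ζˢ` both
primitive, and `sum_pow_smul_eq_zero_iff_of_isPrimitiveRoot` applies with the `ℚ`-structure of
the rational classes (`linearIndependent_of_isRationalClass`). This is the mechanism behind "for all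
`t ∈ (ℤ/m)ˣ`" in Shioda's `𝔅ⁿₘ` and Ran's Prop. 1.7 (iii).
[cite: Ran1980, §1 Prop. 1.7 (iii)] [cite: Shioda1979PJA, §1 eq. (2) and §4] -/
theorem eigenProjector_eq_zero_iff_pow {c : complexBetti (SmoothHypersurface.hypersurface F) k}
    (hc : IsRationalClass c) {s : ℕ} (hs : s.Coprime (Fintype.card G)) :
    eigenProjector F χ k hG c = 0 ↔ eigenProjector F (χ ^ s) k hG c = 0 := by
  classical
  haveI : NeZero (Fintype.card G) := ⟨Fintype.card_ne_zero⟩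
  have hζ := Complex.isPrimitiveRoot_exp (Fintype.card G) (NeZero.ne _)
  choose e _ he using exists_inv_coe_eq_pow χ
  have hN : ((Fintype.card G : ℂ))⁻¹ ≠ 0 := inv_ne_zero (Nat.cast_ne_zero.mpr Fintype.card_ne_zero)
  have h1 : eigenProjector F χ k hG c = 0 ↔
      ∑ a : G, Complex.exp (2 * Real.pi * Complex.I / Fintype.card G) ^ e a •
        singularCohomology.map ℂ ℂ (diagonalMap F (hG a.2)) k c = 0 := by
    rw [eigenProjector_apply, smul_eq_zero, or_iff_right hN]
    simp_rw [he]
  have h2 : eigenProjector F (χ ^ s) k hG c = 0 ↔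
      ∑ a : G, (Complex.exp (2 * Real.pi * Complex.I / Fintype.card G) ^ s) ^ e a •
        singularCohomology.map ℂ ℂ (diagonalMap F (hG a.2)) k c = 0 := by
    rw [eigenProjector_apply, smul_eq_zero, or_iff_right hN]
    have key : ∀ a : G, (((χ ^ s) a : ℂˣ) : ℂ)⁻¹ =
        (Complex.exp (2 * Real.pi * Complex.I / Fintype.card G) ^ s) ^ e a := fun a ↦ by
      rw [MonoidHom.pow_apply, Units.val_pow_eq_pow_val, ← inv_pow, ← he a, ← pow_mul, ← pow_mul,
        Nat.mul_comm]
    simp_rw [key]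
  rw [h1, h2]
  exact sum_pow_smul_eq_zero_iff_of_isPrimitiveRoot (R := {x | IsRationalClass x}) IsRationalClass.zero
    (fun _ _ hx hy ↦ hx.add hy) (fun q _ hx ↦ hx.smul q)
    (fun _ b hb hind ↦ linearIndependent_of_isRationalClass hb hind)
    (fun a ↦ hc.diagonalMap F (hG a.2)) e hζ (hζ.pow_of_coprime s hs)

/-- **`π_χ c = 0 ↔ π_{χ⁻¹} c = 0` for a rational class `c`** (the case `s = |G| - 1`; `V_{χ⁻¹}` is
the complex conjugate of `V_χ`). [cite: Ran1980, §1 Prop. 1.7 (iii)] -/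
theorem eigenProjector_eq_zero_iff_inv {c : complexBetti (SmoothHypersurface.hypersurface F) k}
    (hc : IsRationalClass c) : eigenProjector F χ k hG c = 0 ↔ eigenProjector F χ⁻¹ k hG c = 0 := by
  have hN : 1 ≤ Fintype.card G := Fintype.card_pos
  have hs : (Fintype.card G - 1).Coprime (Fintype.card G) := by
    rw [Nat.Coprime, Nat.gcd_comm, ← Nat.Coprime]
    exact (Nat.coprime_self_sub_right hN).mpr (Nat.coprime_one_right _)
  have hinv : χ ^ (Fintype.card G - 1) = χ⁻¹ := by
    ext a : 1
    rw [MonoidHom.pow_apply, MonoidHom.inv_apply, eq_inv_iff_mul_eq_one, ← pow_succ,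
      Nat.sub_add_cancel hN, ← map_pow, pow_card_eq_one, map_one]
  rw [eigenProjector_eq_zero_iff_pow F hG χ k hc hs, hinv]

end Projector

end Literature.AlgebraicGeometry.HodgeTheory

end
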